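import Summits.QuantumFields.BalabanUV.T4Continuum.Support.NE9CurChartTowerPiLatticeUniformW80
import Literature.MathematicalPhysics.QuantumFieldTheory.Balaban1983to89.B11Eq44COperatorTowerGeometric
import Literature.MathematicalPhysics.QuantumFieldTheory.Balaban1983to89.B9Thm311LaplaceAkPositiveDiagonal
import Literature.MathematicalPhysics.QuantumFieldTheory.Balaban1983to89.B9Eq326OperatorTowerRealityUnitary
import Literature.MathematicalPhysics.QuantumFieldTheory.Balaban1983to89.B9Eq342GreenPrimeSupBound

/-!
# NE9CurChartTowerPiLatticeUniformClassW80 — THE LATTICE-UNIFORM CHART OF `cur U` ON PRINT's SMALL-FIELD CLASS WITH THE CONCRETE W-SLOT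
# `W = (δ/δA′)V` (`B11Eq80Current.W80`): (I-7) `Support/NE9CurChartTowerPiLatticeUniformClass.cur_chart_exists_tower_pi_of_unitary_class_lattice_uniform`
# (ne9-leaf-01 g96: for every height, spacing on the diagonal, period and every UNITARY background of a C⋆-algebra in print's windows (3.35)–(3.36), the
# k-level `cur U` chart at print's operator (3.122) on ONE ball fixed BEFORE the lattice — with an ABSTRACT W-slot `Wq`, `(C₄, a₃)` given) WITH `Wq := W80 ρc τc U
# H̃_{1,k} C_k ε_C J Δ_π` and its Prop. 4 PRODUCED at lattice-free constants — verbatim (I-7)'s proof with the model-block chart (I-5) replaced by this seat's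
# `Support/NE9CurChartTowerPiLatticeUniformW80.cur_chart_exists_tower_pi_lattice_uniform_W80` (gen 97; [Balaban1985Averaging] Prop. 5 (157) on the torus letter
# `C_k` × the one-block letter of `H̃_{1,k}` × the kernel route (68)–(73) → (86) of [Balaban1985Variational]); cell `pub-balaban`, T4-DAG §2 node U3 ∕ §6 NE9,
# route R2′; NE9 crux-team (2) leaf prover 01 (`b2b-balaban-t4-ne9-formalise-leaf-01`, gen 97); Summits-side NEW sibling leaf under this seat's INTERFACE
# REQUEST NE9 [NE9LEAF01-G97-IFR] (HOME/INBOX.md; ruling e34b3e0c (0)); nothing printed asserted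

HONEST FRAMING (T4-DAG PAGE 1).  Rung (B)+1 of the FINITE-VOLUME T⁴ programme — NOT infinite volume, NOT a mass gap, NOT the Clay problem.  NE9 is a
cell NEW ESTIMATE, NOT PRINTED in [Balaban1987RG1] ∕ [Balaban1988RG2Cluster], and NOT PROVED here («NE9 ⇐ the named binders»; spine PROVED 0∕9).  HONEST
DEPENDENCY (cell line, verbatim): continuum YM on T⁴ ⇐ BetaPertH ∧ nine spine estimates (0/9 proved); BetaPertH ⇐ (D1) ∧ (D4) ∧ CAP+tail; G-an2-4
gates asym, D1 and NE2/3/4.  The `cur U` OBJECT is ONE item of the MODEL O-NE9-1 (species (a) data); `act` ∕ `ker` and NEEDS-COORDINATOR #5 untouched.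

WHAT THIS FILE PROVES (ONE theorem; 0 def, 0 sorry, axioms standard).  **`cur_chart_exists_tower_pi_of_unitary_class_lattice_uniform_W80`** — (I-7)'s
statement with the W-slot CONCRETE: for fixed `L ≥ 3`, the fibre ∕ trace letters, print's parameters, the window letter `α₀` with `C_k`'s numerics `ρ` in
[Balaban1985Averaging] Prop. 5's regime (`e^{4cα₀}(1 + 8C₁ρ) ≤ 2`, `4ρ ≤ c₃`, `2dC₃ρ ≤ 1`, `2dθ ≤ L³/16`) and the surjectivity regime, the room `ρ_w`, the
weight-profile bounds `ω, Ω` and the W-slot's LATTICE-FREE letters `(C_V, R_V), M_r, M_t, M_J, M_Δ`: `∃ α₁ j₁ ε₄ ε_C R_b R′` BEFORE `∀`, such that for EVERY `n`, `η`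
with `ηL^{n+1} = 1`, weights `c₀ = η^d`, period `m ≥ 1`, EVERY background `U` with `Ũ ∈ unitaryUnits 𝔸`, `0 ≤ α ≤ α₁` and print's windows (3.35)–(3.36), level maps
with `n+1 ≤ lev₀` and the profile bounds, and EVERY fibre maps `ρc, τc` (`‖ρc‖ ≤ M_r`, `‖τc‖ ≤ M_t`), V₀-slot at `(C_V, R_V)`, currents `J, Δ_π` (`‖J‖₍₋₃₎ ≤ M_J`,
`‖Δ_π‖ ≤ M_Δ`): `∃ h52 hpos′ hposπ` (PRODUCED) and the triple (Ψ1)–(Ψ3) for `chartHB 𝔊̃_k 0 (W80 ρc τc U H̃_{1,k} C_k ε_C J Δ_π) 0 (A′ ↦ A′ + solA H̃_{1,k} 0 C_k 0 ε_C A′)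
ε₄ H̃_{1,k}` at print's operator taken at the produced per-level data (geometric profile) and `QkW_surjective`.
PROOF (verbatim (I-7)): the seven `∃`-first suppliers before `∀`; the feed below the least threshold; (I-5)-W80 at `ϱ := 1∕L`, `AQ := αT∕3`, `G := unitaryUnits 𝔸`; per lattice the
block's fifty letters produced as listed and (I-5) applied at `α := Kα` (`K = 1 + 512(d+1)(d+4)`).
DISGUISE TEST: composition by name; no inequality of the series proved HERE; what stays DISPLAYED is print's class itself (unitarity, the three windows, the
current window), the diagonal bookkeeping `c₀ = η^d`, the weight-profile bounds and the W-slot's lattice-free LETTERS `(C_V, R_V), M_r, M_t, M_J, M_Δ` with the currents `J, Δ_π` themselves; constants crude and symbolic; NOT the gauge step of p. 416, NOT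
the two-background chart, NOT claimed that Bałaban's 𝐇_k ∕ U_j(□₀, exp iB) meet these letters (O-NE9-1; #5 UNRULED); not NE9.  What IS new: the k-level chart
on print's class with print's `W = (δ/δA′)V` in the W-slot and NO radius or constant depending on the height, the spacing or the period.
References (TYPES ∕ loci only): [Balaban1985Variational] (44)–(47) p. 285, (103) p. 293, Prop. 6 (117)–(121) p. 295, (172)–(175) p. 305; [Balaban1985BackgroundPropagators]
(3.35)–(3.37) p. 396, Thm 3.1 (3.42)∕(3.47) pp. 397–398, Thm 3.11 p. 416, (3.122)–(3.126) p. 420, Thm 3.12 p. 423, (3.153) p. 426, Thm 3.13 p. 426; [Balaban1985Averaging]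
Prop. 2 (52)–(54) p. 26, p. 37.
-/

noncomputable section

open Metric Set

namespace Summit.QuantumFields.BalabanUV.T4Continuum.NE9CurChartTowerPiLatticeUniformClassW80

open scoped InnerProductSpace ComplexConjugate BigOperators
open Literature.MathematicalPhysics.QuantumFieldTheory.Balaban1983to89
open B11Eq103H1Complex B11Eq115Space B11Eq174Chart
open B11Eq111FrakG (nabla115)
open B13Contraction113 (QuadAnalytic)
open B9SectCLatticeCarrier (Bond bpos btgt unshift)
open B4Sect5Torus (TSite)
open B7Prop1Explicit (U1 Wcx boxVec)
open B7Prop2Explicit (pdev AvgClosed C0 c2' unitaryUnits avgClosed_unitaryUnits unitaryUnits_le_U1)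
open B7Prop3Flat (c3)
open B9Eq315QTorus (perCfg cornerSite)
open B9Eq315QTower (towerP UlevOf)
open B9Eq326OperatorTower (QkW QkW_surjective laplaceAk)
open B9Eq310HessianOperator (adTransportW)
open B9Eq310DeltaPrime (plaqHolU)
open B9Eq324DeltaPrimeATower (laplacePrimeAk)
open B9Eq3119DeltaPiTower (laplaceAkPi)
open B11Eq44COperatorTower (αT αT_le ulev_mem_U1_of_pdev)
open B11Eq44COperatorTowerGeometric (ulev_reg_of_pdev_geometric geomProfile_nonneg geomProfile_le_αT sum_geomProfile_le)
open B11Eq44CLetterTower (Cck)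
open B9Thm311SmallFieldClosed (hRS_of_unitary)
open B9Eq315QTorusOnto (liftSite perSite_liftSite)
open B7Eq43AveragedSmallnessLevelFree (pdev_perCfg_le_of_plaq)
open B7Eq43AveragedSmallnessLinearFeed (twoWindows_linear_feed)
open B9Thm311SitePrimeFormCoerciveTowerCanonical (exists_strong_site_coercive_tower_diagonal)
open B9Thm311LaplaceAkPiPositiveDiagonal (exists_laplaceAkPi_pos_diagonal_closed)
open B9Thm311LaplaceAkPositiveDiagonal (exists_laplaceAk_pos_diagonal_closed)
open B9Eq326OperatorTowerRealityUnitary (UlevOf_star_eq_inv forall_star_eq_inv_of_mem)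
open B9Eq342GreenPrimeSupBound (norm_adTransportW_eq)
open Summit.QuantumFields.BalabanUV.T4Continuum.NE9CurChartTowerPiLatticeUniformW80 (cur_chart_exists_tower_pi_lattice_uniform_W80)
open B11Eq80Current (W80)
open B11Eq63V0GroupCurrent (curV0)

variable {d : ℕ} (hd : 1 ≤ d) (L : ℕ) [NeZero L] (hL : 1 ≤ L) (hL2 : 2 ≤ L) (hL3 : 3 ≤ L) [Fact (0 < (L : ℝ))]
  {𝔸 : Type*} [CStarAlgebra 𝔸] [Nontrivial 𝔸] [FiniteDimensional ℂ 𝔸]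
  {W : Type*} [NormedAddCommGroup W] [InnerProductSpace ℂ W] [FiniteDimensional ℂ W] (φ : W ≃ₗ[ℂ] 𝔸)
  {Mφ Mφ' : ℝ} (hMφ : 0 ≤ Mφ) (hMφ' : 0 ≤ Mφ') (hφ : ∀ w, ‖φ w‖ ≤ Mφ * ‖w‖) (hφ' : ∀ X, ‖φ.symm X‖ ≤ Mφ' * ‖X‖)
  {a : ℝ} (ha : 0 < a) {a' : ℝ} (ha' : 0 < a')
  (τ : 𝔸 →ₗ[ℂ] ℂ) {Cτ : ℝ} (hτ : ∀ X, ‖τ X‖ ≤ Cτ * ‖X‖) (hCτ : 0 ≤ Cτ) {Mτ : ℝ} (hτm : ∀ X Y : 𝔸, ‖τ (X * Y)‖ ≤ Mτ * ‖X‖ * ‖Y‖) (hMτ : 0 ≤ Mτ)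
  {ρw : ℝ} (hρw : 0 ≤ ρw)
  (hτ₁ : ∀ X : 𝔸, τ (star X) = conj (τ X)) (hτ₂ : ∀ X Y : 𝔸, τ (X * Y) = τ (Y * X)) (hφτ : ∀ X Y : 𝔸, ⟪φ.symm X, φ.symm Y⟫_ℂ = τ (star X * Y))
  {α₀ : ℝ} (hα₀ : 0 < α₀) (hα3 : C0 d * α₀ ≤ 1 / 3) (hα4 : 4 * α₀ ≤ c2' d L)
  (hαL : 50 * (d + 1) * αT d L α₀ * (L : ℝ) ^ d ≤ 1 / 2)
  {ρ : ℝ} (hρ0 : 0 < ρ) (hρ : Real.exp (4 * (800 * ((d : ℝ) + 1) ^ 2 * ((d : ℝ) + 4)) * α₀) * (1 + 8 * (131072 * ((d : ℝ) + 1) ^ 2) * ρ) ≤ 2)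
  (hρ4 : 4 * ρ ≤ c3 d L) (hθ : 2 * d * B7Prop5GeneralLevels.thetaGen d L α₀ ≤ (L : ℝ) ^ 3 / 16) (hC3 : 2 * d * B7Prop5GeneralLevels.C3Gen d L * ρ ≤ 1)
  {ω Ω : ℝ} (hω : 0 ≤ ω) (hΩ : 0 ≤ Ω)
  {CV RV Mr Mt MJ MΔ : ℝ} (hCV : 0 ≤ CV) (hRV : 0 < RV) (hMr : 0 ≤ Mr) (hMt : 0 ≤ Mt) (hMJ : 0 ≤ MJ) (hMΔ : 0 ≤ MΔ)

-- deep definitional unfolding `laplaceAkPi` ↦ `laplaceALatticeK … (π†Δπ) …` in the statement (as the host)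
set_option maxRecDepth 8192 in
set_option maxHeartbeats 1600000 in -- the block is PRODUCED letter by letter and (I-5)'s ≈ 60-binder theorem applied once
include hd hL2 hL3 hMφ hMφ' hφ hφ' ha ha' hτ hCτ hτm hMτ hρw hτ₁ hτ₂ hφτ hα₀ hα3 hα4 hαL hρ0 hρ hρ4 hθ hC3 hω hΩ hCV hRV hMr hMt hMJ hMΔ in
/-- **THE LATTICE-UNIFORM CHART OF `cur U` ON PRINT's SMALL-FIELD CLASS (3.35)–(3.36) WITH THE CONCRETE W-SLOT `W80`** — unitary backgrounds of a C⋆-algebra in the three windows and the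
current window, of ANY height, spacing on the diagonal and period: `∃ α₁ j₁ ε₄ ε_C R_b R′` BEFORE `∀ n η m U`; `∃ h52 hpos′ hposπ` PRODUCED; then (Ψ1)–(Ψ3) for the
chart at print's operator taken at the geometric per-level profile and `QkW_surjective`, the W-slot `W80`'s Prop. 4 produced at lattice-free constants.  (I-5)-W80 with its MODEL block produced by the named suppliers. [folklore]
[cite: Balaban1985BackgroundPropagators, (3.122) p.420, (3.35)–(3.37) p.396, Thm 3.11 p.416, Thm 3.12 p.423, Thm 3.13 p.426; Balaban1985Variational, (103) p.293, Prop. 6 (117)–(121) p.295, (172)–(175) p.305; Balaban1985Averaging, Prop. 2 (52)–(54) p.26, p.37] -/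
theorem cur_chart_exists_tower_pi_of_unitary_class_lattice_uniform_W80 :
    ∃ α₁ j₁ ε₄ εC Rb R' : ℝ, 0 < α₁ ∧ 0 < j₁ ∧ 0 < Rb ∧ 0 < R' ∧
      ∀ (n : ℕ) (η : ℝ) [Fact (0 < η)] (hηL : η * (L : ℝ) ^ (n + 1) = 1) (c₀ c₁ : ℝ) [Fact (0 < c₀)] [Fact (0 < c₁)]
        (_hw : c₀ * ((L : ℝ) ^ (n + 1)) ^ d = c₁) (_hc₀η : c₀ = η ^ d) (_hρ : |η| ^ d / c₀ ≤ ρw) (m : Fin d → ℕ) [∀ i, NeZero (m i)] (_hm : ∀ i, 1 ≤ m i)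
        (U : Bond d (towerP L m (n + 1)) → 𝔸ˣ) (hUG : ∀ (x : B7Prop1Explicit.Site d) (κ : Fin d), perCfg (towerP L m (n + 1)) U x κ ∈ unitaryUnits 𝔸)
        (α : ℝ) (_hα : 0 ≤ α) (_hαle : α ≤ α₁) (_hUη : ∀ b, ‖(U b : 𝔸) - 1‖ ≤ α * η)
        (_hpl : ∀ p : B9SectCLatticeCarrier.Plaq d (towerP L m (n + 1)), ‖(plaqHolU U p : 𝔸) - 1‖ ≤ α * η ^ 2)
        (_hUgrad : ∀ (x : TSite d (towerP L m (n + 1))) (μ : Fin d), ‖(U (x, μ) : 𝔸) - U (unshift μ x, μ)‖ ≤ α * η ^ 2)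
        (j₀ : ℝ) (_hJ : ∀ μ y, ‖B9Eq39Adjoint.J (fun μ => B9Eq33CovDerivVector.shiftEquiv μ) (fun μ y => U (y, μ)) η μ y‖ ≤ j₀) (_hj : j₀ ≤ j₁)
        (lev₀ : Bond d (towerP L m (n + 1)) → ℕ) (lev₁ : Bond d (towerP L m (n + 1)) × Fin d → ℕ) (levB : Bond d m → ℕ) (_hlev : ∀ b, n + 1 ≤ lev₀ b)
        (_hw₀ : (NegSup.wSup (levWeight (L : ℝ) η lev₀ 1) : ℝ) ≤ ω) (_hw₁ : (NegSup.wSup (levWeight (L : ℝ) η lev₁ 2) : ℝ) ≤ ω)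
        (_hw₃ : (NegSup.wInvSup (levWeight (L : ℝ) η lev₀ 3) : ℝ) ≤ Ω) (_hwB : (NegSup.wInvSup (levWeight (L : ℝ) η levB 0) : ℝ) ≤ Ω)
        (ρc : (𝔸 →L[ℂ] ℂ) →L[ℂ] 𝔸) (τc : 𝔸 →L[ℂ] ℂ) (_hρc : ‖ρc‖ ≤ Mr) (_hτc : ‖τc‖ ≤ Mt)
        (_hqV : ∀ Y : Space115 (L : ℝ) η lev₀ lev₁ (nabla115 η U), ‖Y‖ < RV → ‖curV0 (lev₁ := lev₁) (Dc := nabla115 η U) ρc τc U Y‖ ≤ CV * ‖Y‖ ^ 2)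
        (J : NegSize (L : ℝ) η lev₀ 3 𝔸) (Δπ : Space115 (L : ℝ) η lev₀ lev₁ (nabla115 η U) →L[ℂ] NegSize (L : ℝ) η lev₀ 3 𝔸) (_hJn : ‖J‖ ≤ MJ) (_hΔn : ‖Δπ‖ ≤ MΔ),
      ∃ h52 : pdev (perCfg (towerP L m (n + 1)) U) < α₀ * (((L : ℝ) ^ (n + 1))⁻¹) ^ 2,
      ∃ hpos' : ∀ x : SiteL2K ℂ d (towerP L m (n + 1)) c₀ W, x ≠ 0 →
          0 < RCLike.re ⟪x, laplacePrimeAk L m n φ η U a' (c₁ := c₁) x⟫_ℂ,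
      ∃ hposπ : ∀ x : BondL2K ℂ d (towerP L m (n + 1)) c₀ W, x ≠ 0 →
          0 < RCLike.re ⟪x, laplaceAkPi L m n φ τ η U a' hpos' hL (fun j => αT d L α₀ * (((L : ℝ) ^ min (j + 1) (n + 1))⁻¹) ^ 2)
            (fun j => (geomProfile_le_αT (d := d) L (n + 1) hL hα₀.le j).trans (αT_le hL hα4))
            (ulev_mem_U1_of_pdev L m (n + 1) U hL2 (avgClosed_unitaryUnits d L) hUG hα₀ hα3 hα4 h52)
            (ulev_reg_of_pdev_geometric L m (n + 1) U hL2 (avgClosed_unitaryUnits d L) hUG hα₀ hα3 hα4 h52) (c₁ := c₁) a x⟫_ℂ,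
        DifferentiableOn ℂ (chartHB (frakGLatticeCLM (lev₀ := lev₀) φ hposπ
              (QkW_surjective L m n φ U hL _ _ _ _ fun j => le_trans (mul_le_mul_of_nonneg_right (mul_le_mul_of_nonneg_left
                (geomProfile_le_αT (d := d) L (n + 1) hL hα₀.le j) (by positivity)) (by positivity)) hαL) lev₁ (nabla115 η U))
            0 (W80 ρc τc U (H1LatticeCLM (lev₀ := lev₀) (levB := levB) φ hposπ
              (QkW_surjective L m n φ U hL _ _ _ _ fun j => le_trans (mul_le_mul_of_nonneg_right (mul_le_mul_of_nonneg_left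
                (geomProfile_le_αT (d := d) L (n + 1) hL hα₀.le j) (by positivity)) (by positivity)) hαL) lev₁ (nabla115 η U))
              (Cck L m η (n + 1) U lev₀ lev₁ (nabla115 η U) levB) εC J Δπ) 0 (fun A' => A' + solA (H1LatticeCLM (lev₀ := lev₀) (levB := levB) φ hposπ
              (QkW_surjective L m n φ U hL _ _ _ _ fun j => le_trans (mul_le_mul_of_nonneg_right (mul_le_mul_of_nonneg_left
                (geomProfile_le_αT (d := d) L (n + 1) hL hα₀.le j) (by positivity)) (by positivity)) hαL) lev₁ (nabla115 η U)) 0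
              (Cck L m η (n + 1) U lev₀ lev₁ (nabla115 η U) levB) 0 εC A') ε₄
            (H1LatticeCLM (lev₀ := lev₀) (levB := levB) φ hposπ
              (QkW_surjective L m n φ U hL _ _ _ _ fun j => le_trans (mul_le_mul_of_nonneg_right (mul_le_mul_of_nonneg_left
                (geomProfile_le_αT (d := d) L (n + 1) hL hα₀.le j) (by positivity)) (by positivity)) hαL) lev₁ (nabla115 η U)))
          (ball (0 : NegSize (L : ℝ) η levB 0 𝔸) Rb) ∧
        MapsTo (chartHB (frakGLatticeCLM (lev₀ := lev₀) φ hposπ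
              (QkW_surjective L m n φ U hL _ _ _ _ fun j => le_trans (mul_le_mul_of_nonneg_right (mul_le_mul_of_nonneg_left
                (geomProfile_le_αT (d := d) L (n + 1) hL hα₀.le j) (by positivity)) (by positivity)) hαL) lev₁ (nabla115 η U))
            0 (W80 ρc τc U (H1LatticeCLM (lev₀ := lev₀) (levB := levB) φ hposπ
              (QkW_surjective L m n φ U hL _ _ _ _ fun j => le_trans (mul_le_mul_of_nonneg_right (mul_le_mul_of_nonneg_left
                (geomProfile_le_αT (d := d) L (n + 1) hL hα₀.le j) (by positivity)) (by positivity)) hαL) lev₁ (nabla115 η U))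
              (Cck L m η (n + 1) U lev₀ lev₁ (nabla115 η U) levB) εC J Δπ) 0 (fun A' => A' + solA (H1LatticeCLM (lev₀ := lev₀) (levB := levB) φ hposπ
              (QkW_surjective L m n φ U hL _ _ _ _ fun j => le_trans (mul_le_mul_of_nonneg_right (mul_le_mul_of_nonneg_left
                (geomProfile_le_αT (d := d) L (n + 1) hL hα₀.le j) (by positivity)) (by positivity)) hαL) lev₁ (nabla115 η U)) 0
              (Cck L m η (n + 1) U lev₀ lev₁ (nabla115 η U) levB) 0 εC A') ε₄
            (H1LatticeCLM (lev₀ := lev₀) (levB := levB) φ hposπ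
              (QkW_surjective L m n φ U hL _ _ _ _ fun j => le_trans (mul_le_mul_of_nonneg_right (mul_le_mul_of_nonneg_left
                (geomProfile_le_αT (d := d) L (n + 1) hL hα₀.le j) (by positivity)) (by positivity)) hαL) lev₁ (nabla115 η U)))
          (ball (0 : NegSize (L : ℝ) η levB 0 𝔸) Rb) (ball (0 : Space115 (L : ℝ) η lev₀ lev₁ (nabla115 η U)) R') ∧
        chartHB (frakGLatticeCLM (lev₀ := lev₀) φ hposπ
              (QkW_surjective L m n φ U hL _ _ _ _ fun j => le_trans (mul_le_mul_of_nonneg_right (mul_le_mul_of_nonneg_left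
                (geomProfile_le_αT (d := d) L (n + 1) hL hα₀.le j) (by positivity)) (by positivity)) hαL) lev₁ (nabla115 η U))
            0 (W80 ρc τc U (H1LatticeCLM (lev₀ := lev₀) (levB := levB) φ hposπ
              (QkW_surjective L m n φ U hL _ _ _ _ fun j => le_trans (mul_le_mul_of_nonneg_right (mul_le_mul_of_nonneg_left
                (geomProfile_le_αT (d := d) L (n + 1) hL hα₀.le j) (by positivity)) (by positivity)) hαL) lev₁ (nabla115 η U))
              (Cck L m η (n + 1) U lev₀ lev₁ (nabla115 η U) levB) εC J Δπ) 0 (fun A' => A' + solA (H1LatticeCLM (lev₀ := lev₀) (levB := levB) φ hposπ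
              (QkW_surjective L m n φ U hL _ _ _ _ fun j => le_trans (mul_le_mul_of_nonneg_right (mul_le_mul_of_nonneg_left
                (geomProfile_le_αT (d := d) L (n + 1) hL hα₀.le j) (by positivity)) (by positivity)) hαL) lev₁ (nabla115 η U)) 0
              (Cck L m η (n + 1) U lev₀ lev₁ (nabla115 η U) levB) 0 εC A') ε₄
            (H1LatticeCLM (lev₀ := lev₀) (levB := levB) φ hposπ
              (QkW_surjective L m n φ U hL _ _ _ _ fun j => le_trans (mul_le_mul_of_nonneg_right (mul_le_mul_of_nonneg_left
                (geomProfile_le_αT (d := d) L (n + 1) hL hα₀.le j) (by positivity)) (by positivity)) hαL) lev₁ (nabla115 η U)) 0 = 0 := by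
  have hL0 : (0 : ℝ) < L := by exact_mod_cast lt_of_lt_of_le (by norm_num) hL2
  have hr0 : (0 : ℝ) ≤ 1 / (L : ℝ) := by positivity
  have hr1 : 1 / (L : ℝ) < 1 := by rw [div_lt_one hL0]; exact_mod_cast lt_of_lt_of_le (by norm_num) hL2
  have hstar : ∀ X : 𝔸, ‖star X‖ ≤ ‖X‖ := fun X => (norm_star X).le
  have hT0 : 0 ≤ αT d L α₀ := by unfold αT; positivity
  -- (I-5) on the MODEL block at `ϱ := 1∕L`, `AQ := αT∕3`, `G := unitaryUnits 𝔸`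
  obtain ⟨α₁, j₁, ε₄, εC, Rb, R', hα₁, hj₁, hRb0, hR'0, HC⟩ :=
    cur_chart_exists_tower_pi_lattice_uniform_W80 hd L hL hL2 hL3 φ hMφ hMφ' hφ hφ' hstar ha ha' hr0 hr1 τ hτ hCτ hτm hMτ hρw hτ₁ hτ₂ hφτ (αT d L α₀ / 3)
      (avgClosed_unitaryUnits d L) hα₀ hα3 hα4 hρ0 hρ hρ4 hθ hC3 hω hΩ hCV hRV hMr hMt hMJ hMΔ
  -- the three positivity suppliers, `∃`-first
  obtain ⟨αS, γ', hαS, hγ', HS⟩ := exists_strong_site_coercive_tower_diagonal (d := d) L φ hMφ hMφ' hφ hφ' ha' hr0 hr1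
  obtain ⟨αQ, hαQ, HQ⟩ := exists_laplaceAkPi_pos_diagonal_closed (d := d) L hL φ hMφ hMφ' hφ hφ' ha ha' hr0 hr1 τ hτ hCτ hρw
  obtain ⟨αA, hαA, HA⟩ := exists_laplaceAk_pos_diagonal_closed (d := d) L hL φ hMφ hMφ' hφ hφ' ha hr0 hr1 τ hτ hCτ hρw
  -- the α-linear two-window feed below the least threshold
  obtain ⟨T, hT, F⟩ := twoWindows_linear_feed L hL2 (d := d) (𝔸 := 𝔸) (lt_min hα₁ (lt_min hαS (lt_min hαQ hαA)))
  refine ⟨min T (α₀ / 2), j₁, ε₄, εC, Rb, R', lt_min hT (by positivity), hj₁, hRb0, hR'0, ?_⟩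
  intro n η _ hηL c₀ c₁ _ _ hw hc₀η hρ' m _ hm U hUG α hα0 hαle hUη hpl hUgrad j₀ hJ hj' lev₀ lev₁ levB hlev hw₀ hw₁ hw₃ hwB ρc τc hρc' hτc' hqV J Δπ hJn hΔn
  have hη0 : 0 < η := Fact.out
  have hαT' : α ≤ T := hαle.trans (min_le_left _ _)
  have hαh : α ≤ α₀ / 2 := hαle.trans (min_le_right _ _)
  -- the class: `U(b)` unitary, `U(b)⋆ = U(b)⁻¹`, `U(b) ∈ U1`, mutually adjoint transporters
  have hUS : ∀ b, U b ∈ unitaryUnits 𝔸 := fun b => by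
    have h := hUG (liftSite b.1) b.2
    rwa [B9Eq315QTorus.perCfg_apply, perSite_liftSite] at h
  have hUst : ∀ b, star (U b : 𝔸) = (((U b)⁻¹ : 𝔸ˣ) : 𝔸) := forall_star_eq_inv_of_mem hUS
  have hUb : ∀ b, U b ∈ U1 𝔸 := fun b => unitaryUnits_le_U1 (hUS b)
  have hRS := hRS_of_unitary φ τ hφτ hτ₂ U hUst
  -- (52) from the PLAQUETTE window
  have hη : ((L : ℝ) ^ (n + 1))⁻¹ = η := inv_eq_of_mul_eq_one_left hηL
  have h52 : pdev (perCfg (towerP L m (n + 1)) U) < α₀ * (((L : ℝ) ^ (n + 1))⁻¹) ^ 2 := by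
    have hp := pdev_perCfg_le_of_plaq (U := U) hUb (by positivity) hpl
    rw [hη]
    exact lt_of_le_of_lt hp (mul_lt_mul_of_pos_right (by linarith) (by positivity))
  -- every level background unitary ⟹ its fibre transporters preserve the norm
  have hLu : ∀ (j : ℕ) (b : Bond d (towerP L m (j + 1))), star (UlevOf L m (n + 1) U j b : 𝔸) = ((UlevOf L m (n + 1) U j b)⁻¹ : 𝔸ˣ) :=
    UlevOf_star_eq_inv L m n hL2 hUS hα₀ hα3 (by linarith) h52
  have hRlev : ∀ (j : ℕ) (b : Bond d (towerP L m (j + 1))) (w : W), ‖adTransportW φ (UlevOf L m (n + 1) U j) b w‖ ≤ ‖w‖ := fun j b w =>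
    (norm_adTransportW_eq φ (UlevOf L m (n + 1) U j) τ hτ₂ (hLu j) hφτ b w).le
  -- the feed: bond-deviation profile `εU ≤ Kα·L^{−j}`, the windows at `β = Kα`
  obtain ⟨hβ0, hβ1, -, hUη', hpl', hUlev, εU, hεU, hUε, hεg⟩ := F m n (avgClosed_unitaryUnits d L) hUS hηL hα0 hαT' hUη hpl
  have hβ1' : (1 + 512 * (d + 1) * (d + 4)) * α ≤ α₁ := hβ1.trans (min_le_left _ _)
  have hβS : (1 + 512 * (d + 1) * (d + 4)) * α ≤ αS := hβ1.trans ((min_le_right _ _).trans (min_le_left _ _))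
  have hβQ : (1 + 512 * (d + 1) * (d + 4)) * α ≤ αQ := hβ1.trans ((min_le_right _ _).trans ((min_le_right _ _).trans (min_le_left _ _)))
  have hβA : (1 + 512 * (d + 1) * (d + 4)) * α ≤ αA := hβ1.trans ((min_le_right _ _).trans ((min_le_right _ _).trans (min_le_right _ _)))
  have hαβ : α ≤ (1 + 512 * (d + 1) * (d + 4)) * α := by
    have h1 : (1 : ℝ) ≤ 1 + 512 * (d + 1) * (d + 4) := by
      have : (0 : ℝ) ≤ 512 * (d + 1) * (d + 4) := by positivity
      linarith
    exact le_mul_of_one_le_left hα0 h1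
  have hUgrad' : ∀ (x : TSite d (towerP L m (n + 1))) (μ : Fin d), ‖(U (x, μ) : 𝔸) - U (unshift μ x, μ)‖ ≤ (1 + 512 * (d + 1) * (d + 4)) * α * η ^ 2 :=
    fun x μ => (hUgrad x μ).trans (mul_le_mul_of_nonneg_right hαβ (by positivity))
  -- the per-level data at the geometric profile
  have hα0' : ∀ j, 0 ≤ αT d L α₀ * (((L : ℝ) ^ min (j + 1) (n + 1))⁻¹) ^ 2 := geomProfile_nonneg (d := d) L (n + 1) hα₀.le
  have hαL' : ∀ j, 50 * (d + 1) * (αT d L α₀ * (((L : ℝ) ^ min (j + 1) (n + 1))⁻¹) ^ 2) * (L : ℝ) ^ d ≤ 1 / 2 := fun j =>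
    le_trans (mul_le_mul_of_nonneg_right (mul_le_mul_of_nonneg_left (geomProfile_le_αT (d := d) L (n + 1) hL hα₀.le j) (by positivity))
      (by positivity)) hαL
  have hAQ : ∑ j ∈ Finset.range (n + 1), αT d L α₀ * (((L : ℝ) ^ min (j + 1) (n + 1))⁻¹) ^ 2 ≤ αT d L α₀ / 3 :=
    sum_geomProfile_le (d := d) L (n + 1) hL2 hα₀.le
  -- the three positivity witnesses at the produced data
  have hpos' : ∀ x : SiteL2K ℂ d (towerP L m (n + 1)) c₀ W, x ≠ 0 →
      0 < RCLike.re ⟪x, laplacePrimeAk L m n φ η U a' (c₁ := c₁) x⟫_ℂ := fun x hx => by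
    have h := HS n η hηL c₀ c₁ hw m U hRS _ hβ0 hβS hUb hUη' εU hεU hεg hUε hUlev x
    have hx' : 0 < ‖x‖ := norm_pos_iff.2 hx
    have h2 : 0 < γ' * (‖covDerivL2K ℂ c₀ ((η : ℂ))⁻¹ (adTransportW φ (fun _ : Bond d (towerP L m (n + 1)) => (1 : 𝔸ˣ))) x‖ ^ 2 +
        ‖x‖ ^ 2) := mul_pos hγ' (add_pos_of_nonneg_of_pos (sq_nonneg _) (pow_pos hx' 2))
    linarith
  refine ⟨h52, hpos', ?_⟩
  have hposπ : ∀ x : BondL2K ℂ d (towerP L m (n + 1)) c₀ W, x ≠ 0 →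
      0 < RCLike.re ⟪x, laplaceAkPi L m n φ τ η U a' hpos' hL (fun j => αT d L α₀ * (((L : ℝ) ^ min (j + 1) (n + 1))⁻¹) ^ 2)
        (fun j => (geomProfile_le_αT (d := d) L (n + 1) hL hα₀.le j).trans (αT_le hL hα4))
        (ulev_mem_U1_of_pdev L m (n + 1) U hL2 (avgClosed_unitaryUnits d L) hUG hα₀ hα3 hα4 h52)
        (ulev_reg_of_pdev_geometric L m (n + 1) U hL2 (avgClosed_unitaryUnits d L) hUG hα₀ hα3 hα4 h52) (c₁ := c₁) a x⟫_ℂ := fun x hx =>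
    HQ n η hηL c₀ c₁ hw hρ' m U _ _ _ _ εU hεU hUε hβ0 hβQ hRS hUb hUη' hpl' hεg hUlev hpos' x hx
  refine ⟨hposπ, ?_⟩
  have hpos : ∀ x : BondL2K ℂ d (towerP L m (n + 1)) c₀ W, x ≠ 0 →
      0 < RCLike.re ⟪x, laplaceAk L m n φ η U hL (fun j => αT d L α₀ * (((L : ℝ) ^ min (j + 1) (n + 1))⁻¹) ^ 2)
        (fun j => (geomProfile_le_αT (d := d) L (n + 1) hL hα₀.le j).trans (αT_le hL hα4))
        (ulev_mem_U1_of_pdev L m (n + 1) U hL2 (avgClosed_unitaryUnits d L) hUG hα₀ hα3 hα4 h52)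
        (ulev_reg_of_pdev_geometric L m (n + 1) U hL2 (avgClosed_unitaryUnits d L) hUG hα₀ hα3 hα4 h52) τ (c₀ := c₀) (c₁ := c₁) a x⟫_ℂ :=
    fun x hx => HA n η hηL c₀ c₁ hw hρ' m U _ _ _ _ εU hεU hUε hβ0 hβA hRS hUb hUη' hpl' hεg x hx
  -- (I-5) at the produced block (`α := Kα`)
  exact HC n η hηL c₀ c₁ hw hρ' m hm U _ hα0' _ hαL' _ _ εU hεU hUε hUlev _ hβ0 hβ1' hUst hUb hUη' hpl' hUgrad' hRlev hεg hAQ hpos' hpos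
    hc₀η j₀ hJ hj' hposπ _ hUG lev₀ lev₁ levB hlev hw₀ hw₁ hw₃ hwB ρc τc hρc' hτc' hqV J Δπ hJn hΔn

end Summit.QuantumFields.BalabanUV.T4Continuum.NE9CurChartTowerPiLatticeUniformClassW80

end
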